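import Literature.NumberTheory.LFunctions.WeilArchDensityMoments
import Literature.NumberTheory.LFunctions.WeilWindowSuzukiAsymptoticProofs
import Literature.Analysis.ValidatedNumerics.ExpPoly.Correlation
import HarnessLib

/-!
# The archimedean density of Weil's explicit formula, III: the regularised density `g(t) = t ρ(t)`,
# panel decomposition of `∫ g · q`, and the exponential-series enclosure of the tail `∫_L^∞ ρ`

Topic `Literature/NumberTheory/LFunctions` (sequel of `WeilArchDensityMoments.lean`).  For the certified
evaluation of the archimedean term `∫₀^∞ ρ(t) D(t) dt` of the Weil energy of a windowed polynomial trial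
vector (increment `D(t) = t·E(t)` on `[0, 2b]`, exact polynomial `E` of degree ≈ 110 whose monomial
coefficients reach `10³⁰` — so that `D` must be re-centred on short panels), this file provides the
problem-side identities; the numerical side (Taylor models of `g` per panel, `TaylorModelExp.lean`,
`TaylorModelQuadrature.lean`) is generic.

* `weilArchDensityG t = t ρ(t)` (value `1/2` at `t = 0`, its limit), measurable, `0 ≤ g(t) ≤ t + 1/2` on
  `t ≥ 0` (`weilArchDensityG_nonneg`, `weilArchDensityG_le`), hence `g · q` is interval integrable on
  `[a, b] ⊂ [0, ∞)` for continuous `q` (`intervalIntegrable_weilArchDensityG_mul`);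
* `intervalIntegral_eq_sum_panels` — `∫₀^{2Nh} f = Σ_{k<N} ∫_{-h}^{h} f((2k+1)h + ρ) dρ` (generic), and
  `integral_weilArchDensityG_mul_eval_eq_sum` — the same for `g · q`, `q : Poly`, with the re-centred
  polynomials `q((2k+1)h + ρ) = (BPoly.subst (BPoly.taylor q) [(2k+1)h])(ρ)` of `ExpPoly/Correlation.lean`
  (exact rational data);
* `weilArchDensity_tail_eq_sum_add` / `weilArchDensity_tail_rem_le` — for `L > 0`,
  `∫_{(L,∞)} ρ = Σ_{m<M} e^{-(2m+½)L}/(2m+½) + R_M`, `0 ≤ R_M ≤ e^{-(2M+½)L}(1 + 1/(2L))/(2M+½)`,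
  (integrability of `ρ` on `(L, ∞)` is part of the statement; cf. `integrableOn_weilArchDensity_Ioi` of
  `WeilWindowSuzukiProofs.lean`).

## References

* E. Bombieri, *Remarks on Weil's quadratic functional in the theory of prime numbers, I*, Rend. Mat.
  Acc. Lincei (9) 11 (2000) 183–233, Thm 2 (the density `x dx/(x²−1)`, `x = e^t`). [cite: Bombieri2000Weil, Thm 2]
* Geometric series / termwise integration of `e^{-t/2} Σ e^{-2mt}`. [folklore]
-/

open Real Set MeasureTheory Finset intervalIntegral
open scoped BigOperators Topology

namespace Literature.NumberTheory.LFunctions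

open Literature.Analysis.ValidatedNumerics.ExpPoly

/-! ## The regularised density `g(t) = t ρ(t)` -/

/-- `g(t) = t ρ(t)` for `t ≠ 0`, and `g(0) = 1/2 = lim_{t→0} t ρ(t)`. [folklore] -/
noncomputable def weilArchDensityG (t : ℝ) : ℝ := if t = 0 then 1 / 2 else t * weilArchDensity t

/-- [folklore] -/
theorem weilArchDensityG_of_ne {t : ℝ} (ht : t ≠ 0) : weilArchDensityG t = t * weilArchDensity t := if_neg ht

/-- `ρ(t) · (t · x) = g(t) · x` for `t > 0`. [folklore] -/
theorem weilArchDensity_mul_mul {t : ℝ} (ht : 0 < t) (x : ℝ) :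
    weilArchDensity t * (t * x) = weilArchDensityG t * x := by
  rw [weilArchDensityG_of_ne ht.ne']; ring

/-- `g` is measurable. [folklore] -/
theorem measurable_weilArchDensityG : Measurable weilArchDensityG :=
  Measurable.ite (measurableSet_singleton 0) measurable_const (measurable_id.mul measurable_weilArchDensity)

/-- `ρ(t) ≤ e^{-t/2}(1 + 1/(2t))` for `t > 0` (the case `M = 0` of the remainder bound). [folklore] -/
theorem weilArchDensity_le_exp_mul {t : ℝ} (ht : 0 < t) :
    weilArchDensity t ≤ Real.exp (-(t / 2)) * (1 + 1 / (2 * t)) := by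
  have h := weilArchDensity_eq_sum_add_rem ht 0
  rw [Finset.sum_range_zero, zero_add] at h
  have h2 := weilArchDensityRem_le ht 0
  simp only [Nat.cast_zero, mul_zero, zero_add] at h2
  have e : (1 / 2 : ℝ) * t = t / 2 := by ring
  rw [e] at h2
  rwa [h]

/-- `0 ≤ g(t)` for `t ≥ 0`. [folklore] -/
theorem weilArchDensityG_nonneg {t : ℝ} (ht : 0 ≤ t) : 0 ≤ weilArchDensityG t := by
  rcases ht.eq_or_lt with h | h
  · rw [← h, weilArchDensityG, if_pos rfl]; norm_num
  · rw [weilArchDensityG_of_ne h.ne']; exact mul_nonneg h.le (weilArchDensity_pos h).le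

/-- `g(t) ≤ t + 1/2` for `t ≥ 0`. [folklore] -/
theorem weilArchDensityG_le {t : ℝ} (ht : 0 ≤ t) : weilArchDensityG t ≤ t + 1 / 2 := by
  rcases ht.eq_or_lt with h | h
  · rw [← h, weilArchDensityG, if_pos rfl]; norm_num
  · rw [weilArchDensityG_of_ne h.ne']
    have h1 := weilArchDensity_le_exp_mul h
    have he : Real.exp (-(t / 2)) ≤ 1 := Real.exp_le_one_iff.2 (by linarith)
    have hpos : 0 ≤ 1 + 1 / (2 * t) := by positivity
    calc t * weilArchDensity t ≤ t * (Real.exp (-(t / 2)) * (1 + 1 / (2 * t))) :=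
          mul_le_mul_of_nonneg_left h1 h.le
      _ ≤ t * (1 * (1 + 1 / (2 * t))) := by gcongr
      _ = t + 1 / 2 := by field_simp

/-- `g` is integrable on every `[a, b] ⊂ [0, ∞)`. [folklore] -/
theorem intervalIntegrable_weilArchDensityG {a b : ℝ} (ha : 0 ≤ a) (hab : a ≤ b) :
    IntervalIntegrable weilArchDensityG volume a b := by
  rw [intervalIntegrable_iff_integrableOn_Icc_of_le hab]
  have hconst : IntegrableOn (fun _ : ℝ ↦ b + 1 / 2) (Icc a b) := continuous_const.integrableOn_Icc
  refine Integrable.mono' hconst measurable_weilArchDensityG.aestronglyMeasurable.restrict ?_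
  refine (ae_restrict_mem measurableSet_Icc).mono fun t ht ↦ ?_
  have ht0 : 0 ≤ t := ha.trans ht.1
  rw [Real.norm_eq_abs, abs_of_nonneg (weilArchDensityG_nonneg ht0)]
  exact (weilArchDensityG_le ht0).trans (by linarith [ht.2])

/-- `g · q` is integrable on every `[a, b] ⊂ [0, ∞)` for continuous `q`. [folklore] -/
theorem intervalIntegrable_weilArchDensityG_mul {a b : ℝ} (ha : 0 ≤ a) (hab : a ≤ b) {q : ℝ → ℝ}
    (hq : Continuous q) : IntervalIntegrable (fun t ↦ weilArchDensityG t * q t) volume a b :=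
  (intervalIntegrable_weilArchDensityG ha hab).mul_continuousOn hq.continuousOn

/-! ## Panels -/

/-- **Panel decomposition**: `∫₀^{2Nh} f = Σ_{k<N} ∫_{-h}^{h} f((2k+1)h + ρ) dρ` for `f` interval integrable on
the subintervals of `[0, ∞)`. [folklore] -/
theorem intervalIntegral_eq_sum_panels (f : ℝ → ℝ) {h : ℝ} (hh : 0 ≤ h)
    (hf : ∀ a b : ℝ, 0 ≤ a → a ≤ b → IntervalIntegrable f volume a b) :
    ∀ N : ℕ, ∫ t in (0 : ℝ)..(2 * N * h), f t =
      ∑ k ∈ Finset.range N, ∫ ρ in (-h)..h, f ((2 * k + 1) * h + ρ)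
  | 0 => by simp
  | N + 1 => by
      rw [Finset.sum_range_succ, ← intervalIntegral_eq_sum_panels f hh hf N]
      have h1 : IntervalIntegrable f volume 0 (2 * N * h) := hf _ _ le_rfl (by positivity)
      have h2 : IntervalIntegrable f volume (2 * N * h) (2 * (N + 1 : ℕ) * h) :=
        hf _ _ (by positivity) (by push_cast; nlinarith)
      rw [← integral_add_adjacent_intervals h1 h2]
      congr 1
      have hs := intervalIntegral.integral_comp_add_right f ((2 * N + 1) * h) (a := -h) (b := h)
      have e1 : -h + (2 * N + 1) * h = 2 * N * h := by ring
      have e2 : h + (2 * N + 1) * h = 2 * (N + 1 : ℕ) * h := by push_cast; ring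
      rw [e1, e2] at hs
      rw [← hs]
      refine integral_congr fun ρ _ ↦ ?_
      simp only [add_comm ρ]

/-- **Panel decomposition of `∫ g·q` with exactly re-centred polynomials**: for `q : Poly`, `h > 0`,
`∫₀^{2Nh} g(t) q(t) dt = Σ_{k<N} ∫_{-h}^{h} g(c_k + ρ) · (BPoly.subst (BPoly.taylor q) [c_k])(ρ) dρ`,
`c_k = (2k+1)h`. [folklore] -/
theorem integral_weilArchDensityG_mul_eval_eq_sum (q : Poly) {h : ℚ} (hh : 0 < h) (N : ℕ) :
    ∫ t in (0 : ℝ)..(2 * N * h), weilArchDensityG t * Poly.eval q t =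
      ∑ k ∈ Finset.range N, ∫ ρ in (-(h : ℝ))..h,
        weilArchDensityG ((((2 * k + 1 : ℕ) : ℚ) * h : ℚ) + ρ) *
          Poly.eval (BPoly.subst (BPoly.taylor q) [((2 * k + 1 : ℕ) : ℚ) * h]) ρ := by
  have hhr : (0 : ℝ) ≤ h := by exact_mod_cast hh.le
  rw [intervalIntegral_eq_sum_panels (fun t ↦ weilArchDensityG t * Poly.eval q t) hhr
    (fun a b ha hab ↦ intervalIntegrable_weilArchDensityG_mul ha hab (Poly.continuous_eval q)) N]
  refine Finset.sum_congr rfl fun k _ ↦ integral_congr fun ρ _ ↦ ?_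
  simp only [BPoly.eval_subst, BPoly.eval_taylor, Poly.eval_cons, Poly.eval_nil, mul_zero, add_zero]
  push_cast
  ring_nf

/-! ## The tail `∫_{(L, ∞)} ρ` -/

/-- Termwise: `∫_{(L,∞)} e^{-(2m+½)t} dt = e^{-(2m+½)L}/(2m+½)`, with integrability. [folklore] -/
theorem integral_exp_term_Ioi (m : ℕ) (L : ℝ) :
    IntegrableOn (fun t : ℝ ↦ Real.exp (-((2 * m + 1 / 2) * t))) (Ioi L) ∧
      ∫ t in Ioi L, Real.exp (-((2 * m + 1 / 2) * t)) = Real.exp (-((2 * m + 1 / 2) * L)) / (2 * m + 1 / 2) := by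
  have ha : -(2 * (m : ℝ) + 1 / 2) < 0 := by have : (0 : ℝ) ≤ m := Nat.cast_nonneg m; linarith
  have e : (fun t : ℝ ↦ Real.exp (-((2 * m + 1 / 2) * t))) = fun t ↦ Real.exp (-(2 * (m : ℝ) + 1 / 2) * t) := by
    funext t; ring_nf
  rw [e]
  refine ⟨integrableOn_exp_mul_Ioi ha L, ?_⟩
  rw [integral_exp_mul_Ioi ha L]
  have : (2 * (m : ℝ) + 1 / 2) ≠ 0 := by positivity
  rw [neg_mul, div_neg, neg_div, neg_neg]

/-- The remainder density is continuous on `(0, ∞)`. [folklore] -/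
theorem continuousOn_weilArchDensityRem (M : ℕ) : ContinuousOn (weilArchDensityRem M) (Ioi 0) := by
  intro t ht
  have hq1 : Real.exp (-(2 * t)) < 1 := Real.exp_lt_one_iff.2 (by have := Set.mem_Ioi.1 ht; linarith)
  unfold weilArchDensityRem
  exact (ContinuousAt.div (by fun_prop) (by fun_prop) (by linarith)).continuousWithinAt

/-- The remainder is integrable on `(L, ∞)`, `L > 0`, with
`0 ≤ ∫_{(L,∞)} rem_M ≤ e^{-(2M+½)L}(1 + 1/(2L))/(2M+½)`. [folklore] -/
theorem weilArchDensity_tail_rem_le {L : ℝ} (hL : 0 < L) (M : ℕ) :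
    IntegrableOn (weilArchDensityRem M) (Ioi L) ∧ 0 ≤ ∫ t in Ioi L, weilArchDensityRem M t ∧
      ∫ t in Ioi L, weilArchDensityRem M t ≤
        Real.exp (-((2 * M + 1 / 2) * L)) * (1 + 1 / (2 * L)) / (2 * M + 1 / 2) := by
  obtain ⟨hint, hval⟩ := integral_exp_term_Ioi M L
  have hdom : IntegrableOn (fun t : ℝ ↦ Real.exp (-((2 * M + 1 / 2) * t)) * (1 + 1 / (2 * L))) (Ioi L) :=
    hint.mul_const _
  have hmeas : AEStronglyMeasurable (weilArchDensityRem M) (volume.restrict (Ioi L)) :=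
    ((continuousOn_weilArchDensityRem M).mono (Ioi_subset_Ioi hL.le)).aestronglyMeasurable measurableSet_Ioi
  have hpt : ∀ t ∈ Ioi L, weilArchDensityRem M t ≤ Real.exp (-((2 * M + 1 / 2) * t)) * (1 + 1 / (2 * L)) := by
    intro t ht
    have ht0 : 0 < t := hL.trans ht
    refine (weilArchDensityRem_le ht0 M).trans ?_
    gcongr
    · exact ht.le
  have hI : IntegrableOn (weilArchDensityRem M) (Ioi L) := by
    refine Integrable.mono' hdom hmeas ?_
    refine (ae_restrict_mem measurableSet_Ioi).mono fun t ht ↦ ?_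
    rw [Real.norm_eq_abs, abs_of_nonneg (weilArchDensityRem_nonneg (hL.trans ht) M)]
    exact hpt t ht
  refine ⟨hI, setIntegral_nonneg measurableSet_Ioi fun t ht ↦ weilArchDensityRem_nonneg (hL.trans ht) M, ?_⟩
  calc ∫ t in Ioi L, weilArchDensityRem M t
      ≤ ∫ t in Ioi L, Real.exp (-((2 * M + 1 / 2) * t)) * (1 + 1 / (2 * L)) :=
        setIntegral_mono_on hI hdom measurableSet_Ioi hpt
    _ = Real.exp (-((2 * M + 1 / 2) * L)) * (1 + 1 / (2 * L)) / (2 * M + 1 / 2) := by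
        rw [MeasureTheory.integral_mul_const, hval]; ring

/-- **Exponential-series enclosure of the tail**: for `L > 0` and every `M`,
`∫_{(L,∞)} ρ = Σ_{m<M} e^{-(2m+½)L}/(2m+½) + ∫_{(L,∞)} rem_M`, and `ρ` is integrable on `(L, ∞)`. [folklore] -/
theorem weilArchDensity_tail_eq_sum_add {L : ℝ} (hL : 0 < L) (M : ℕ) :
    IntegrableOn weilArchDensity (Ioi L) ∧
      ∫ t in Ioi L, weilArchDensity t =
        (∑ m ∈ Finset.range M, Real.exp (-((2 * m + 1 / 2) * L)) / (2 * m + 1 / 2)) +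
          ∫ t in Ioi L, weilArchDensityRem M t := by
  have hrem := (weilArchDensity_tail_rem_le hL M).1
  have hsumI : IntegrableOn (fun t : ℝ ↦ ∑ m ∈ Finset.range M, Real.exp (-((2 * m + 1 / 2) * t))) (Ioi L) :=
    integrable_finsetSum _ fun m _ ↦ (integral_exp_term_Ioi m L).1
  have heq : EqOn weilArchDensity
      (fun t ↦ (∑ m ∈ Finset.range M, Real.exp (-((2 * m + 1 / 2) * t))) + weilArchDensityRem M t) (Ioi L) :=
    fun t ht ↦ weilArchDensity_eq_sum_add_rem (hL.trans ht) M
  have hI : IntegrableOn weilArchDensity (Ioi L) := (hsumI.add hrem).congr_fun heq.symm measurableSet_Ioi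
  refine ⟨hI, ?_⟩
  rw [setIntegral_congr_fun measurableSet_Ioi heq, integral_add hsumI hrem,
    integral_finsetSum _ fun m _ ↦ (integral_exp_term_Ioi m L).1]
  congr 1
  exact Finset.sum_congr rfl fun m _ ↦ (integral_exp_term_Ioi m L).2

end Literature.NumberTheory.LFunctions
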